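import Summits.QuantumFields.BalabanUV.Beta.D1BFx.NeedleNdlNdlLetterForms

/-!
# `BalabanUV.Beta.D1BFx.NeedleNdlNdlPairings` — road «BF-x» for binder row D1, slot (K), END row `hGrp gN`, «GN-33 ∕ NN» PAIRINGS: the four pairings
# `𝔅(row_p, C_u)`, `𝔅(C_p, row_u)`, `𝔅(C_p, C_u)`, `𝔅(row_p, row_u)` of the `ndl ⊗ ndl` word AT THE TREE'S OBJECTS (`Ga`, `ndlRow`, the combined column)
# with n-FREE constants, block decay in `dist(blk p, blk u)` and the needle weights OUTSIDE — `≤ K·e^{−(δ∕4)·d}·W_p`, `K·e^{…}·W_u`, `K·n⁴·e^{…}`, `K·n⁻³·M(p,u)`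

HONEST DEPENDENCY (cell records, verbatim): «continuum YM on T⁴ ⇐ BetaPertH ∧ nine spine estimates (0/9 proved); BetaPertH ⇐ (D1) ∧ (D4) ∧
CAP+tail; G-an2-4 gates asym, D1 and NE2/3/4.»  HONEST FRAMING (cell contract, verbatim): «discharging `BetaPertH` makes Bałaban's UV stability
UNCONDITIONAL — a real constructive-QFT result; it is NOT the continuum limit and NOT the Clay problem.»  THIS MODULE DISCHARGES NOTHING of the
wall: [folklore] bookkeeping BY NAME over this lineage's `NeedleNdlNdlLetters` (abstract pairing letters) and `NeedleNdlNdlLetterForms` (the tree's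
three letters at a common rate, site ↔ block decay, bracket arithmetic); the gluon leg's damped entry profile `kG·e^{−(δG∕n)‖y−x‖}∕nrm(y−x)²` is a HYPOTHESIS here (supplied modulo
[B5, Prop. 1.2] ∧ [B5, (1.126)–(1.127)] by leaf-04-g9's `GluonLegProfile.exists_abs_Ga_le_profile` in the cell file).  No `def`, no `def … : Prop`, nothing cited,
0 sorry.  Root-level binders hW ∕ hR-sockets ∕ hSX-socket ∕ D1Tel ∕ D1Rep — 0 discharged; (K) NOT closed; NOT D1, NOT `BetaPertH`, NOT continuum, NOT Clay.

ABSOLUTE RULE (cell charter, verbatim): «No internally-minted statement may enter as a cited fact. Every hypothesis is either kernel-proved in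
this package or a verbatim quotation of a PUBLISHED theorem with page reference. The manuscript(s) under audit are NOT citable for their own
disputed steps — they are the thing under adjudication; programme-internal (2001/route/tribunal) claims are never citable.»

WHY (owner claim table «GN-CELLS» v0.2, R3 cell `ndl ⊗ ndl`; an3-g57 §3′ (4) R3⊗R3; MINE journal 2026-08-21 l.30734).  With `W(κ,p) := Σ_{s∈B(blk p)} |qJet n κ p (blk p) s|`
(needle weight, `≤ n^{κ+1}n⁻⁴`) and `M := Σ_{s,s′} |qJet_p s|·|qJet_u s′|∕nrm(s−s′)` (the two-needle Coulomb functional), §3′ (4)'s four pairing sizes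
`k·n^{λ′−3}`, `k·n^{λ−3}`, `k·n⁴`, `k·n^{λ+λ′−6}·(log)` become `K·W_p`, `K·W_u`, `K·n⁴`, `K·n⁻³·M` with block decay `e^{−(δ∕4)·dist(blk p, blk u)}` on the first
three — the form in which the cell's w-sum is booked by the bond marginal `NeedleBondMarginal.sum_bond_abs_qJet_le` (`Σ_{p∈B(β)} W ≤ n−1`,
`Σ_{p∈B(β)} M ≤ (n−1)n⁻⁴·c n³·W_u`).  The common damping rate is `δ∕n`, `δ := min (dR a∕2) (min δG (min δ_PP δ_P))` (R-column, leg, combined column).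

CONTENT (`a > 0`, `n ≥ 1`; the combined column spelled out as `q ↦ cQ·Σ_{z∈B(blk u)} Pgt n a z q − kerP (n−1) a q (blk u)`).
* [folklore] `rate_le`; **`exists_row_col_bound`** (`K·e^{−(δ∕4)d}·W_p`), **`exists_col_row_bound`** (`K·e^{−(δ∕4)d}·W_u`), **`exists_col_col_bound`** (`K·n⁴·e^{−(δ∕4)d}`),
  **`exists_row_row_bound`** (`K·n⁻³·M(p,u)`) — each `K ≥ 0` chosen BEFORE `n` (n-free by quantifier order), the leg profile a hypothesis at each `n`, `|cQ| ≤ cQ₀`.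
NOT HERE (honest): the letter forms (`NeedleNdlNdlLetterForms`), the word, the census, the cell — `NeedleNdlNdlRow`.
Unit `b2b-balaban-gan24-formalise-leaf-05` (gen 42), G-an2-4 swarm leaf prover on cross-lane kernel duty; `LEAVES-BFx.md` row (N) «GN-33∕NN».
-/

noncomputable section

namespace Summit.QuantumFields.BalabanUV.Beta.D1BFx.NeedleNdlNdlPairings

open Finset
open scoped BigOperators
open Literature.MathematicalPhysics.QuantumFieldTheory.Balaban1983to89
open Literature.MathematicalPhysics.QuantumFieldTheory.Balaban1983to89.Beta
open B6QGQLower276 (X e blk B mem_B)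
open ExpKernelCalculus (Site MKer)
open Beta.PoissonInterior (nrm nrm_pos)
open DyadicShell (Pt)
open Summit.QuantumFields.BalabanUV.Beta.D1BFx.RProjector (Pgt kerP deltaPP deltaP deltaPP_pos deltaP_pos)
open Summit.QuantumFields.BalabanUV.Beta.D1BFx.ProjectorSupNorm (cPPs cPs cPPs_nonneg cPs_nonneg)
open Summit.QuantumFields.BalabanUV.Beta.D1BFx.GluonLeg (Ga)
open Summit.QuantumFields.BalabanUV.Beta.D1BFx.GhostStencil (qJet)
open Summit.QuantumFields.BalabanUV.Beta.D1BFx.NeedlePotentialLetters (ndlRow)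
open Summit.QuantumFields.BalabanUV.Beta.D1BFx.RColumnBlockMass (dR dR_pos)
open Summit.QuantumFields.BalabanUV.Beta.D1BFx.RColumnProfile (kP kV_nonneg_and)
open Summit.QuantumFields.BalabanUV.Beta.D1BFx.RankOneBubble (pairing applyK)
open Summit.QuantumFields.BalabanUV.Beta.D1BFx.RankOneBubbleJets (grad)
open Summit.QuantumFields.BalabanUV.Beta.D1BFx.NeedleNdlNdlLetters (abs_pairing_needle_leg_needle_le abs_pairing_needle_leg_flat_le
  abs_pairing_flat_leg_needle_le abs_pairing_flat_leg_flat_le)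
open Summit.QuantumFields.BalabanUV.Beta.D1BFx.NeedleNdlNdlLetterForms (c2_le c3_le c1_le c0_le cg_le abs_grad_ndlRow_le exp_site_le_exp_blk abs_grad_col_le
  abs_Ga_le_of_profile)

variable (n : ℕ) [NeZero n] {a : ℝ} (cQ : ℝ)

/-! ## §3 The four pairings with block decay -/

section Pairings

variable {n cQ}

omit [NeZero n] in
/-- [folklore] the common bookkeeping of the three needle∕column letters at scale `n`: the rate `δ∕n` lies below every native rate. -/
theorem rate_le {δ r : ℝ} (hle : δ ≤ r) (hn : (0 : ℝ) < n) : δ / n ≤ r / n := div_le_div_of_nonneg_right hle hn.le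

variable (a cQ) in
/-- [folklore] **`𝔅(row_p, C_u)` — NEEDLE OUTSIDE, COLUMN INSIDE, n-FREE**: one `K ≥ 0` (chosen before `n`) with, for every `n ≥ 1`, every `|cQ| ≤ cQ₀`, every
leg obeying the damped entry profile `kG·e^{−(δG∕n)‖y−x‖}∕nrm(y−x)²`, and all bonds,
`|pairing (grad (ndlRow n a κ p)) (applyK (Ga n a) (grad C_u))| ≤ K·e^{−(δ∕4)·dist(blk p, blk u)}·Σ_{s∈B(blk p)} |qJet_p s|`, `δ = min (dR a∕2) (min δG (min δ_PP δ_P))`. -/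
theorem exists_row_col_bound (ha : 0 < a) {kG δG : ℝ} (hkG : 0 ≤ kG) (hδG : 0 < δG) (cQ₀ : ℝ) :
    ∃ K : ℝ, 0 ≤ K ∧ ∀ (n : ℕ) [NeZero n] (cQ : ℝ), |cQ| ≤ cQ₀ →
      (∀ (x y : Pt) (κ l : Fin 4), |Ga n a x y κ l| ≤ kG * Real.exp (-(δG / n) * Beta.PoissonInterior.supNorm (y - x)) / nrm (y - x) ^ 2) →
      ∀ (κ : Fin 4) (p u : Site 4),
        |pairing (grad (ndlRow n a κ p))
            (applyK (Ga n a) (grad (fun q => cQ * (∑ z ∈ B (n - 1) (blk (n - 1) u), Pgt n a z q () ()) - kerP (d := 4) (n - 1) a q (blk (n - 1) u))))|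
          ≤ K * Real.exp (-(min (dR a / 2) (min δG (min (deltaPP 4 a) (deltaP 4 a))) / 4 * dist (blk (n - 1) p) (blk (n - 1) u)))
              * ∑ s ∈ B (n - 1) (blk (n - 1) p), |qJet n κ p (blk (n - 1) p) s| := by
  have hPP := deltaPP_pos 4 ha; have hP := deltaP_pos 4 ha; have hdR := dR_pos ha
  set δC := min (deltaPP 4 a) (deltaP 4 a) with hδC
  have hδC0 : 0 < δC := lt_min hPP hP
  set δ := min (dR a / 2) (min δG δC) with hδ
  have hδ0 : 0 < δ := lt_min (half_pos hdR) (lt_min hδG hδC0)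
  have hδR : δ ≤ dR a / 2 := min_le_left _ _
  have hδG' : δ ≤ δG := (min_le_right _ _).trans (min_le_left _ _)
  have hδC' : δ ≤ δC := (min_le_right _ _).trans (min_le_right _ _)
  have hkP := (kV_nonneg_and ha).2
  have hcQ₀' : ∀ cQ : ℝ, |cQ| ≤ cQ₀ → 0 ≤ cQ₀ := fun cQ h => (abs_nonneg cQ).trans h
  set C₁ := (cQ₀ * cPPs 4 a + cPs 4 a) * Real.exp δC with hC₁
  set c2' : ℝ := 1 + 2 * 4 * 3 ^ (4 - 1) * (4 / δ * (1 + 4 / δ)) with hc2'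
  set c3' : ℝ := 1 + 2 * 4 * 3 ^ (4 - 1) * (1 + 8 / δ) with hc3'
  refine ⟨4 * (4 * kG * |C₁| * kP a * c2' * c3') * Real.exp (δ / 4), by positivity, fun n _ cQ hcQ hG κ p u => ?_⟩
  have hn : (0 : ℝ) < n := by exact_mod_cast Nat.pos_of_ne_zero (NeZero.ne n)
  have hn1 : 1 ≤ n := NeZero.one_le
  have hQ0 := hcQ₀' cQ hcQ
  set ε := δ / n with hε
  have hε0 : 0 < ε := div_pos hδ0 hn
  set C₀ := (|cQ| * cPPs 4 a + cPs 4 a) * Real.exp δC with hC₀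
  have hPPs := cPPs_nonneg 4 ha; have hPs := cPs_nonneg 4 ha
  have hC₀0 : 0 ≤ C₀ := by positivity
  have hC₀1 : C₀ ≤ |C₁| := by
    refine le_trans ?_ (le_abs_self _)
    rw [hC₀, hC₁]; gcongr
  -- the three letters at the common rate ε
  have hA := abs_Ga_le_of_profile n hkG (rate_le hδG' hn) hG
  have hεR : ε ≤ dR a / 2 / n := by rw [hε]; exact rate_le hδR hn
  have hψ := fun x c => abs_grad_ndlRow_le n ha hεR κ p x c
  have hχ : ∀ (q : Site 4) (c : Fin 4),
      |grad (fun q => cQ * (∑ z ∈ B (n - 1) (blk (n - 1) u), Pgt n a z q () ()) - kerP (d := 4) (n - 1) a q (blk (n - 1) u)) q c|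
        ≤ C₀ / n * Real.exp (-ε * Beta.PoissonInterior.supNorm (q - u)) :=
    fun q c => abs_grad_col_le n cQ ha (rate_le hδC' hn) u q c
  have h := abs_pairing_needle_leg_flat_le (F := Fin 4) (A := Ga n a) (B (n - 1) (blk (n - 1) p)) (fun s _ => abs_nonneg _)
    hkG (by positivity : 0 ≤ kP a / (n : ℝ) ^ 2) (by positivity : 0 ≤ C₀ / n) hε0 (fun s => s) u hA hψ hχ
  refine h.trans ?_
  -- the brackets are polynomial in `n` and the powers cancel
  have hc2 : 1 + 2 * 4 * 3 ^ (4 - 1) * ((4 - 1 - 2).factorial * (2 / (ε / 2)) ^ (4 - 1 - 2) * (1 + 2 / (ε / 2))) ≤ c2' * (n : ℝ) ^ 2 :=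
    c2_le hδ0 hn1
  have hc3 : 1 + 2 * 4 * 3 ^ (4 - 1) * ((4 - 1 - 3).factorial * (2 / (ε / 2 / 2)) ^ (4 - 1 - 3) * (1 + 2 / (ε / 2 / 2))) ≤ c3' * (n : ℝ) ^ 1 :=
    c3_le hδ0 hn1
  have hc2_0 : 0 ≤ 1 + 2 * 4 * 3 ^ (4 - 1) * ((4 - 1 - 2).factorial * (2 / (ε / 2)) ^ (4 - 1 - 2) * (1 + 2 / (ε / 2))) := by positivity
  have hc3_0 : 0 ≤ 1 + 2 * 4 * 3 ^ (4 - 1) * ((4 - 1 - 3).factorial * (2 / (ε / 2 / 2)) ^ (4 - 1 - 3) * (1 + 2 / (ε / 2 / 2))) := by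
    positivity
  have hpre : (4 : ℝ) * (4 * kG * (C₀ / n) * (kP a / (n : ℝ) ^ 2) *
      (1 + 2 * 4 * 3 ^ (4 - 1) * ((4 - 1 - 2).factorial * (2 / (ε / 2)) ^ (4 - 1 - 2) * (1 + 2 / (ε / 2)))) *
      (1 + 2 * 4 * 3 ^ (4 - 1) * ((4 - 1 - 3).factorial * (2 / (ε / 2 / 2)) ^ (4 - 1 - 3) * (1 + 2 / (ε / 2 / 2)))))
      ≤ 4 * (4 * kG * |C₁| * kP a * c2' * c3') := by
    have hcard : (Fintype.card (Fin 4) : ℝ) = 4 := by simp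
    calc (4 : ℝ) * (4 * kG * (C₀ / n) * (kP a / (n : ℝ) ^ 2) *
          (1 + 2 * 4 * 3 ^ (4 - 1) * ((4 - 1 - 2).factorial * (2 / (ε / 2)) ^ (4 - 1 - 2) * (1 + 2 / (ε / 2)))) *
          (1 + 2 * 4 * 3 ^ (4 - 1) * ((4 - 1 - 3).factorial * (2 / (ε / 2 / 2)) ^ (4 - 1 - 3) * (1 + 2 / (ε / 2 / 2)))))
        ≤ 4 * (4 * kG * (|C₁| / n) * (kP a / (n : ℝ) ^ 2) * (c2' * (n : ℝ) ^ 2) * (c3' * (n : ℝ) ^ 1)) := by gcongr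
      _ = 4 * (4 * kG * |C₁| * kP a * c2' * c3') := by field_simp
  -- the site damping at rate ε∕4 becomes block decay at rate δ∕4
  have hsum : ∑ s ∈ B (n - 1) (blk (n - 1) p), |qJet n κ p (blk (n - 1) p) s| * Real.exp (-(ε / 2 / 2) * Beta.PoissonInterior.supNorm (s - u))
      ≤ Real.exp (δ / 4) * Real.exp (-(δ / 4 * dist (blk (n - 1) p) (blk (n - 1) u))) *
          ∑ s ∈ B (n - 1) (blk (n - 1) p), |qJet n κ p (blk (n - 1) p) s| := by
    rw [Finset.mul_sum]
    refine Finset.sum_le_sum fun s hs => ?_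
    have e4 : -(ε / 2 / 2) = -(δ / 4 / n) := by rw [hε]; ring
    rw [e4]
    have h1 := exp_site_le_exp_blk n (δ := δ / 4) (by positivity) hs u
    calc |qJet n κ p (blk (n - 1) p) s| * Real.exp (-(δ / 4 / n) * Beta.PoissonInterior.supNorm (s - u))
        ≤ |qJet n κ p (blk (n - 1) p) s| * (Real.exp (δ / 4) * Real.exp (-(δ / 4 * dist (blk (n - 1) p) (blk (n - 1) u)))) :=
          mul_le_mul_of_nonneg_left h1 (abs_nonneg _)
      _ = _ := by ring
  have hcard : (Fintype.card (Fin 4) : ℝ) = 4 := by simp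
  rw [hcard]
  have hW0 : 0 ≤ ∑ s ∈ B (n - 1) (blk (n - 1) p), |qJet n κ p (blk (n - 1) p) s| := Finset.sum_nonneg fun s _ => abs_nonneg _
  calc (4 : ℝ) * (4 * kG * (C₀ / n) * (kP a / (n : ℝ) ^ 2) *
        (1 + 2 * 4 * 3 ^ (4 - 1) * ((4 - 1 - 2).factorial * (2 / (ε / 2)) ^ (4 - 1 - 2) * (1 + 2 / (ε / 2)))) *
        (1 + 2 * 4 * 3 ^ (4 - 1) * ((4 - 1 - 3).factorial * (2 / (ε / 2 / 2)) ^ (4 - 1 - 3) * (1 + 2 / (ε / 2 / 2))))) *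
        ∑ s ∈ B (n - 1) (blk (n - 1) p), |qJet n κ p (blk (n - 1) p) s| * Real.exp (-(ε / 2 / 2) * Beta.PoissonInterior.supNorm (s - u))
      ≤ 4 * (4 * kG * |C₁| * kP a * c2' * c3') * (Real.exp (δ / 4) * Real.exp (-(δ / 4 * dist (blk (n - 1) p) (blk (n - 1) u))) *
          ∑ s ∈ B (n - 1) (blk (n - 1) p), |qJet n κ p (blk (n - 1) p) s|) :=
        mul_le_mul hpre hsum (Finset.sum_nonneg fun s _ => by positivity) (by positivity)
    _ = _ := by ring

variable (a) in
/-- [folklore] **`𝔅(C_p, row_u)` — COLUMN OUTSIDE, NEEDLE INSIDE, n-FREE**: one `K ≥ 0` with, for every `n ≥ 1`, `|cQ| ≤ cQ₀`, profiled leg and all bonds,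
`|pairing (grad C_p) (applyK (Ga n a) (grad (ndlRow n a κ u)))| ≤ K·e^{−(δ∕4)·dist(blk p, blk u)}·Σ_{s∈B(blk u)} |qJet_u s|`. -/
theorem exists_col_row_bound (ha : 0 < a) {kG δG : ℝ} (hkG : 0 ≤ kG) (hδG : 0 < δG) (cQ₀ : ℝ) :
    ∃ K : ℝ, 0 ≤ K ∧ ∀ (n : ℕ) [NeZero n] (cQ : ℝ), |cQ| ≤ cQ₀ →
      (∀ (x y : Pt) (κ l : Fin 4), |Ga n a x y κ l| ≤ kG * Real.exp (-(δG / n) * Beta.PoissonInterior.supNorm (y - x)) / nrm (y - x) ^ 2) →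
      ∀ (κ : Fin 4) (p u : Site 4),
        |pairing (grad (fun q => cQ * (∑ z ∈ B (n - 1) (blk (n - 1) p), Pgt n a z q () ()) - kerP (d := 4) (n - 1) a q (blk (n - 1) p)))
            (applyK (Ga n a) (grad (ndlRow n a κ u)))|
          ≤ K * Real.exp (-(min (dR a / 2) (min δG (min (deltaPP 4 a) (deltaP 4 a))) / 4 * dist (blk (n - 1) p) (blk (n - 1) u)))
              * ∑ s ∈ B (n - 1) (blk (n - 1) u), |qJet n κ u (blk (n - 1) u) s| := by
  have hPP := deltaPP_pos 4 ha; have hP := deltaP_pos 4 ha; have hdR := dR_pos ha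
  set δC := min (deltaPP 4 a) (deltaP 4 a) with hδC
  have hδC0 : 0 < δC := lt_min hPP hP
  set δ := min (dR a / 2) (min δG δC) with hδ
  have hδ0 : 0 < δ := lt_min (half_pos hdR) (lt_min hδG hδC0)
  have hδR : δ ≤ dR a / 2 := min_le_left _ _
  have hδG' : δ ≤ δG := (min_le_right _ _).trans (min_le_left _ _)
  have hδC' : δ ≤ δC := (min_le_right _ _).trans (min_le_right _ _)
  have hkP := (kV_nonneg_and ha).2
  set C₁ := (cQ₀ * cPPs 4 a + cPs 4 a) * Real.exp δC with hC₁
  set C₄ : ℝ := 4 * 2 ^ (4 + 3) * 9 ^ (4 - 1) with hC₄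
  set c1' : ℝ := 1 + 2 * 4 * 3 ^ (4 - 1) * (2 * (4 / δ) ^ 2 * (1 + 4 / δ)) with hc1'
  refine ⟨4 * (4 * kG * kP a * C₄ * |C₁| * c1') * Real.exp (δ / 2), by positivity, fun n _ cQ hcQ hG κ p u => ?_⟩
  have hn : (0 : ℝ) < n := by exact_mod_cast Nat.pos_of_ne_zero (NeZero.ne n)
  have hn1 : 1 ≤ n := NeZero.one_le
  have hQ0 : 0 ≤ cQ₀ := (abs_nonneg cQ).trans hcQ
  set ε := δ / n with hε
  have hε0 : 0 < ε := div_pos hδ0 hn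
  set C₀ := (|cQ| * cPPs 4 a + cPs 4 a) * Real.exp δC with hC₀
  have hPPs := cPPs_nonneg 4 ha; have hPs := cPs_nonneg 4 ha
  have hC₀0 : 0 ≤ C₀ := by positivity
  have hC₀1 : C₀ ≤ |C₁| := by
    refine le_trans ?_ (le_abs_self _)
    rw [hC₀, hC₁]; gcongr
  have hA := abs_Ga_le_of_profile n hkG (rate_le hδG' hn) hG
  have hεR : ε ≤ dR a / 2 / n := by rw [hε]; exact rate_le hδR hn
  have hφ := fun x c => abs_grad_ndlRow_le n ha hεR κ u x c
  have hψ : ∀ (q : Site 4) (c : Fin 4),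
      |grad (fun q => cQ * (∑ z ∈ B (n - 1) (blk (n - 1) p), Pgt n a z q () ()) - kerP (d := 4) (n - 1) a q (blk (n - 1) p)) q c|
        ≤ C₀ / n * Real.exp (-ε * Beta.PoissonInterior.supNorm (q - p)) :=
    fun q c => abs_grad_col_le n cQ ha (rate_le hδC' hn) p q c
  have h := abs_pairing_flat_leg_needle_le (F := Fin 4) (A := Ga n a) (B (n - 1) (blk (n - 1) u)) (fun s _ => abs_nonneg _)
    hkG (by positivity : 0 ≤ kP a / (n : ℝ) ^ 2) (by positivity : 0 ≤ C₀ / n) hε0 (fun s => s) p hA hψ hφ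
  refine h.trans ?_
  have hc1 : 1 + 2 * 4 * 3 ^ (4 - 1) * ((4 - 1 - 1).factorial * (2 / (ε / 2)) ^ (4 - 1 - 1) * (1 + 2 / (ε / 2))) ≤ c1' * (n : ℝ) ^ 3 :=
    c1_le hδ0 hn1
  have hpre : (4 : ℝ) * (4 * kG * (kP a / (n : ℝ) ^ 2) * (4 * 2 ^ (4 + 3) * 9 ^ (4 - 1)) * (C₀ / n) *
      (1 + 2 * 4 * 3 ^ (4 - 1) * ((4 - 1 - 1).factorial * (2 / (ε / 2)) ^ (4 - 1 - 1) * (1 + 2 / (ε / 2)))))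
      ≤ 4 * (4 * kG * kP a * C₄ * |C₁| * c1') := by
    calc (4 : ℝ) * (4 * kG * (kP a / (n : ℝ) ^ 2) * (4 * 2 ^ (4 + 3) * 9 ^ (4 - 1)) * (C₀ / n) *
          (1 + 2 * 4 * 3 ^ (4 - 1) * ((4 - 1 - 1).factorial * (2 / (ε / 2)) ^ (4 - 1 - 1) * (1 + 2 / (ε / 2)))))
        ≤ 4 * (4 * kG * (kP a / (n : ℝ) ^ 2) * (4 * 2 ^ (4 + 3) * 9 ^ (4 - 1)) * (|C₁| / n) * (c1' * (n : ℝ) ^ 3)) := by gcongr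
      _ = 4 * (4 * kG * kP a * C₄ * |C₁| * c1') := by rw [hC₄]; field_simp
  have hsum : ∑ s ∈ B (n - 1) (blk (n - 1) u), |qJet n κ u (blk (n - 1) u) s| * Real.exp (-(ε / 2) * Beta.PoissonInterior.supNorm (s - p))
      ≤ Real.exp (δ / 2) * Real.exp (-(δ / 4 * dist (blk (n - 1) p) (blk (n - 1) u))) *
          ∑ s ∈ B (n - 1) (blk (n - 1) u), |qJet n κ u (blk (n - 1) u) s| := by
    rw [Finset.mul_sum]
    refine Finset.sum_le_sum fun s hs => ?_
    have e4 : -(ε / 2) = -(δ / 2 / n) := by rw [hε]; ring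
    rw [e4]
    have h1 := exp_site_le_exp_blk n (δ := δ / 2) (by positivity) hs p
    have hD : 0 ≤ dist (blk (n - 1) p) (blk (n - 1) u) := dist_nonneg
    have h2 : Real.exp (-(δ / 2 * dist (blk (n - 1) u) (blk (n - 1) p))) ≤ Real.exp (-(δ / 4 * dist (blk (n - 1) p) (blk (n - 1) u))) := by
      rw [dist_comm]; exact Real.exp_le_exp.2 (by nlinarith)
    calc |qJet n κ u (blk (n - 1) u) s| * Real.exp (-(δ / 2 / n) * Beta.PoissonInterior.supNorm (s - p))
        ≤ |qJet n κ u (blk (n - 1) u) s| * (Real.exp (δ / 2) * Real.exp (-(δ / 4 * dist (blk (n - 1) p) (blk (n - 1) u)))) :=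
          mul_le_mul_of_nonneg_left (h1.trans (mul_le_mul_of_nonneg_left h2 (Real.exp_pos _).le)) (abs_nonneg _)
      _ = _ := by ring
  have hcard : (Fintype.card (Fin 4) : ℝ) = 4 := by simp
  rw [hcard]
  calc (4 : ℝ) * (4 * kG * (kP a / (n : ℝ) ^ 2) * (4 * 2 ^ (4 + 3) * 9 ^ (4 - 1)) * (C₀ / n) *
        (1 + 2 * 4 * 3 ^ (4 - 1) * ((4 - 1 - 1).factorial * (2 / (ε / 2)) ^ (4 - 1 - 1) * (1 + 2 / (ε / 2))))) *
        ∑ s ∈ B (n - 1) (blk (n - 1) u), |qJet n κ u (blk (n - 1) u) s| * Real.exp (-(ε / 2) * Beta.PoissonInterior.supNorm (s - p))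
      ≤ 4 * (4 * kG * kP a * C₄ * |C₁| * c1') * (Real.exp (δ / 2) * Real.exp (-(δ / 4 * dist (blk (n - 1) p) (blk (n - 1) u))) *
          ∑ s ∈ B (n - 1) (blk (n - 1) u), |qJet n κ u (blk (n - 1) u) s|) :=
        mul_le_mul hpre hsum (Finset.sum_nonneg fun s _ => by positivity) (by positivity)
    _ = _ := by ring

variable (a) in
/-- [folklore] **`𝔅(C_p, C_u)` — COLUMN × LEG × COLUMN, `K·n⁴`**: one `K ≥ 0` with, for every `n ≥ 1`, `|cQ| ≤ cQ₀`, profiled leg and all sites `p`, `u`,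
`|pairing (grad C_p) (applyK (Ga n a) (grad C_u))| ≤ K·n⁴·e^{−(δ∕4)·dist(blk p, blk u)}` (an3 §3′ (4) «`𝔅(C,C′) ≤ S′_C·m′_{C′}·kn² = k·n⁴`», here with decay). -/
theorem exists_col_col_bound (ha : 0 < a) {kG δG : ℝ} (hkG : 0 ≤ kG) (hδG : 0 < δG) (cQ₀ : ℝ) :
    ∃ K : ℝ, 0 ≤ K ∧ ∀ (n : ℕ) [NeZero n] (cQ : ℝ), |cQ| ≤ cQ₀ →
      (∀ (x y : Pt) (κ l : Fin 4), |Ga n a x y κ l| ≤ kG * Real.exp (-(δG / n) * Beta.PoissonInterior.supNorm (y - x)) / nrm (y - x) ^ 2) →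
      ∀ (p u : Site 4),
        |pairing (grad (fun q => cQ * (∑ z ∈ B (n - 1) (blk (n - 1) p), Pgt n a z q () ()) - kerP (d := 4) (n - 1) a q (blk (n - 1) p)))
            (applyK (Ga n a) (grad (fun q => cQ * (∑ z ∈ B (n - 1) (blk (n - 1) u), Pgt n a z q () ()) - kerP (d := 4) (n - 1) a q (blk (n - 1) u))))|
          ≤ K * (n : ℝ) ^ 4 * Real.exp (-(min (dR a / 2) (min δG (min (deltaPP 4 a) (deltaP 4 a))) / 4 * dist (blk (n - 1) p) (blk (n - 1) u))) := by
  have hPP := deltaPP_pos 4 ha; have hP := deltaP_pos 4 ha; have hdR := dR_pos ha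
  set δC := min (deltaPP 4 a) (deltaP 4 a) with hδC
  have hδC0 : 0 < δC := lt_min hPP hP
  set δ := min (dR a / 2) (min δG δC) with hδ
  have hδ0 : 0 < δ := lt_min (half_pos hdR) (lt_min hδG hδC0)
  have hδG' : δ ≤ δG := (min_le_right _ _).trans (min_le_left _ _)
  have hδC' : δ ≤ δC := (min_le_right _ _).trans (min_le_right _ _)
  set C₁ := (cQ₀ * cPPs 4 a + cPs 4 a) * Real.exp δC with hC₁
  set c2' : ℝ := 1 + 2 * 4 * 3 ^ (4 - 1) * (4 / δ * (1 + 4 / δ)) with hc2'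
  set c0' : ℝ := 1 + 2 * 4 * 3 ^ (4 - 1) * (6 * (8 / δ) ^ 3 * (1 + 8 / δ)) with hc0'
  refine ⟨4 * |C₁| * (4 * kG * |C₁| * c2') * Real.exp (δ / 4) * c0', by positivity, fun n _ cQ hcQ hG p u => ?_⟩
  have hn : (0 : ℝ) < n := by exact_mod_cast Nat.pos_of_ne_zero (NeZero.ne n)
  have hn1 : 1 ≤ n := NeZero.one_le
  have hQ0 : 0 ≤ cQ₀ := (abs_nonneg cQ).trans hcQ
  set ε := δ / n with hε
  have hε0 : 0 < ε := div_pos hδ0 hn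
  set C₀ := (|cQ| * cPPs 4 a + cPs 4 a) * Real.exp δC with hC₀
  have hPPs := cPPs_nonneg 4 ha; have hPs := cPs_nonneg 4 ha
  have hC₀0 : 0 ≤ C₀ := by positivity
  have hC₀1 : C₀ ≤ |C₁| := by
    refine le_trans ?_ (le_abs_self _)
    rw [hC₀, hC₁]; gcongr
  have hA := abs_Ga_le_of_profile n hkG (rate_le hδG' hn) hG
  have hψ : ∀ (q : Site 4) (c : Fin 4),
      |grad (fun q => cQ * (∑ z ∈ B (n - 1) (blk (n - 1) p), Pgt n a z q () ()) - kerP (d := 4) (n - 1) a q (blk (n - 1) p)) q c|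
        ≤ C₀ / n * Real.exp (-ε * Beta.PoissonInterior.supNorm (q - p)) :=
    fun q c => abs_grad_col_le n cQ ha (rate_le hδC' hn) p q c
  have hχ : ∀ (q : Site 4) (c : Fin 4),
      |grad (fun q => cQ * (∑ z ∈ B (n - 1) (blk (n - 1) u), Pgt n a z q () ()) - kerP (d := 4) (n - 1) a q (blk (n - 1) u)) q c|
        ≤ C₀ / n * Real.exp (-ε * Beta.PoissonInterior.supNorm (q - u)) :=
    fun q c => abs_grad_col_le n cQ ha (rate_le hδC' hn) u q c
  have h := abs_pairing_flat_leg_flat_le (F := Fin 4) (A := Ga n a) hkG (by positivity : 0 ≤ C₀ / n) (by positivity : 0 ≤ C₀ / n) hε0 p u hA hψ hχ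
  refine h.trans ?_
  have hc2 : 1 + 2 * 4 * 3 ^ (4 - 1) * ((4 - 1 - 2).factorial * (2 / (ε / 2)) ^ (4 - 1 - 2) * (1 + 2 / (ε / 2))) ≤ c2' * (n : ℝ) ^ 2 :=
    c2_le hδ0 hn1
  have hc0 : 1 + 2 * 4 * 3 ^ (4 - 1) * ((4 - 1 - 0).factorial * (2 / (ε / 2 / 2)) ^ (4 - 1 - 0) * (1 + 2 / (ε / 2 / 2))) ≤ c0' * (n : ℝ) ^ 4 :=
    c0_le hδ0 hn1
  have hexp : Real.exp (-(ε / 2 / 2) * Beta.PoissonInterior.supNorm (p - u))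
      ≤ Real.exp (δ / 4) * Real.exp (-(δ / 4 * dist (blk (n - 1) p) (blk (n - 1) u))) := by
    have e4 : -(ε / 2 / 2) = -(δ / 4 / n) := by rw [hε]; ring
    rw [e4]
    exact exp_site_le_exp_blk n (δ := δ / 4) (by positivity) (mem_B.2 rfl) u
  have hcard : (Fintype.card (Fin 4) : ℝ) = 4 := by simp
  rw [hcard]
  calc (4 : ℝ) * (C₀ / n) * (4 * kG * (C₀ / n) *
        (1 + 2 * 4 * 3 ^ (4 - 1) * ((4 - 1 - 2).factorial * (2 / (ε / 2)) ^ (4 - 1 - 2) * (1 + 2 / (ε / 2))))) *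
        Real.exp (-(ε / 2 / 2) * Beta.PoissonInterior.supNorm (p - u)) *
        (1 + 2 * 4 * 3 ^ (4 - 1) * ((4 - 1 - 0).factorial * (2 / (ε / 2 / 2)) ^ (4 - 1 - 0) * (1 + 2 / (ε / 2 / 2))))
      ≤ 4 * (|C₁| / n) * (4 * kG * (|C₁| / n) * (c2' * (n : ℝ) ^ 2)) *
          (Real.exp (δ / 4) * Real.exp (-(δ / 4 * dist (blk (n - 1) p) (blk (n - 1) u)))) * (c0' * (n : ℝ) ^ 4) := by
        gcongr
    _ = 4 * |C₁| * (4 * kG * |C₁| * c2') * Real.exp (δ / 4) * c0' * (n : ℝ) ^ 4 *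
          Real.exp (-(δ / 4 * dist (blk (n - 1) p) (blk (n - 1) u))) := by
        field_simp
    _ = _ := by ring

variable (a) in
/-- [folklore] **`𝔅(row_p, row_u)` — NEEDLE × LEG × NEEDLE, `K·n⁻³·M(p,u)`**: one `K ≥ 0` with, for every `n ≥ 1`, profiled leg, all bonds `(κ,p)`, `(κ′,u)`,
`|pairing (grad (ndlRow n a κ p)) (applyK (Ga n a) (grad (ndlRow n a κ′ u)))| ≤ K·n⁻³·Σ_{s∈B(blk p)} Σ_{s′∈B(blk u)} |qJet_p s|·|qJet_u s′|∕nrm(s−s′)`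
(an3 §3′ (3) «`𝔅(ρ_u,ρ_{u′}) ≤ k n⁻⁴·(1 + log(n∕nrm(u−u′)))`», the logarithm paid by the power gain of `NeedleHLSGain`). -/
theorem exists_row_row_bound (ha : 0 < a) {kG δG : ℝ} (hkG : 0 ≤ kG) (hδG : 0 < δG) :
    ∃ K : ℝ, 0 ≤ K ∧ ∀ (n : ℕ) [NeZero n],
      (∀ (x y : Pt) (κ l : Fin 4), |Ga n a x y κ l| ≤ kG * Real.exp (-(δG / n) * Beta.PoissonInterior.supNorm (y - x)) / nrm (y - x) ^ 2) →
      ∀ (κ κ' : Fin 4) (p u : Site 4),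
        |pairing (grad (ndlRow n a κ p)) (applyK (Ga n a) (grad (ndlRow n a κ' u)))|
          ≤ K * ((n : ℝ) ^ 3)⁻¹ * ∑ s ∈ B (n - 1) (blk (n - 1) p), ∑ s' ∈ B (n - 1) (blk (n - 1) u),
              |qJet n κ p (blk (n - 1) p) s| * |qJet n κ' u (blk (n - 1) u) s'| / nrm (s - s') := by
  have hPP := deltaPP_pos 4 ha; have hP := deltaP_pos 4 ha; have hdR := dR_pos ha
  set δC := min (deltaPP 4 a) (deltaP 4 a) with hδC
  have hδC0 : 0 < δC := lt_min hPP hP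
  set δ := min (dR a / 2) (min δG δC) with hδ
  have hδ0 : 0 < δ := lt_min (half_pos hdR) (lt_min hδG hδC0)
  have hδR : δ ≤ dR a / 2 := min_le_left _ _
  have hδG' : δ ≤ δG := (min_le_right _ _).trans (min_le_left _ _)
  have hkP := (kV_nonneg_and ha).2
  set C₄ : ℝ := 4 * 2 ^ (4 + 3) * 9 ^ (4 - 1) with hC₄
  set cg' : ℝ := (1 + 2 * 4 * 3 ^ (4 - 1)) * (2 + 3 ^ (4 - 1)) * (1 + 2 / δ) with hcg'
  refine ⟨4 * (4 * kG * kP a * kP a * C₄ * cg'), by positivity, fun n _ hG κ κ' p u => ?_⟩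
  have hn : (0 : ℝ) < n := by exact_mod_cast Nat.pos_of_ne_zero (NeZero.ne n)
  have hn1 : 1 ≤ n := NeZero.one_le
  set ε := δ / n with hε
  have hε0 : 0 < ε := div_pos hδ0 hn
  have hA := abs_Ga_le_of_profile n hkG (rate_le hδG' hn) hG
  have hεR : ε ≤ dR a / 2 / n := by rw [hε]; exact rate_le hδR hn
  have hψ := fun x c => abs_grad_ndlRow_le n ha hεR κ p x c
  have hχ := fun x c => abs_grad_ndlRow_le n ha hεR κ' u x c
  have h := abs_pairing_needle_leg_needle_le (F := Fin 4) (A := Ga n a) (B (n - 1) (blk (n - 1) p)) (B (n - 1) (blk (n - 1) u))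
    (fun s _ => abs_nonneg _) (fun s _ => abs_nonneg _) hkG (by positivity : 0 ≤ kP a / (n : ℝ) ^ 2) (by positivity : 0 ≤ kP a / (n : ℝ) ^ 2)
    hε0 (fun s => s) (fun s => s) hA hψ hχ
  refine h.trans ?_
  have hcg : (1 + 2 * 4 * 3 ^ (4 - 1)) * (2 + 3 ^ (4 - 1)) * (1 + 2 / ε) ≤ cg' * (n : ℝ) ^ 1 := cg_le hδ0 hn1
  have hM0 : 0 ≤ ∑ s ∈ B (n - 1) (blk (n - 1) p), ∑ s' ∈ B (n - 1) (blk (n - 1) u),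
      |qJet n κ p (blk (n - 1) p) s| * |qJet n κ' u (blk (n - 1) u) s'| / nrm (s - s') :=
    Finset.sum_nonneg fun s _ => Finset.sum_nonneg fun s' _ => by have := nrm_pos (s - s'); positivity
  have hcard : (Fintype.card (Fin 4) : ℝ) = 4 := by simp
  rw [hcard]
  calc (4 : ℝ) * (4 * kG * (kP a / (n : ℝ) ^ 2) * (kP a / (n : ℝ) ^ 2) * (4 * 2 ^ (4 + 3) * 9 ^ (4 - 1)) *
        ((1 + 2 * 4 * 3 ^ (4 - 1)) * (2 + 3 ^ (4 - 1)) * (1 + 2 / ε))) *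
        ∑ s ∈ B (n - 1) (blk (n - 1) p), ∑ s' ∈ B (n - 1) (blk (n - 1) u),
          |qJet n κ p (blk (n - 1) p) s| * |qJet n κ' u (blk (n - 1) u) s'| / nrm (s - s')
      ≤ 4 * (4 * kG * (kP a / (n : ℝ) ^ 2) * (kP a / (n : ℝ) ^ 2) * (4 * 2 ^ (4 + 3) * 9 ^ (4 - 1)) * (cg' * (n : ℝ) ^ 1)) *
        ∑ s ∈ B (n - 1) (blk (n - 1) p), ∑ s' ∈ B (n - 1) (blk (n - 1) u),
          |qJet n κ p (blk (n - 1) p) s| * |qJet n κ' u (blk (n - 1) u) s'| / nrm (s - s') := by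
        gcongr
    _ = 4 * (4 * kG * kP a * kP a * C₄ * cg') * ((n : ℝ) ^ 3)⁻¹ *
        ∑ s ∈ B (n - 1) (blk (n - 1) p), ∑ s' ∈ B (n - 1) (blk (n - 1) u),
          |qJet n κ p (blk (n - 1) p) s| * |qJet n κ' u (blk (n - 1) u) s'| / nrm (s - s') := by
        rw [hC₄]; field_simp

end Pairings

end Summit.QuantumFields.BalabanUV.Beta.D1BFx.NeedleNdlNdlPairings

end
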